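import Mathlib.Analysis.Normed.Module.Connected
import Mathlib.Analysis.Complex.Basic
import Mathlib.LinearAlgebra.Complex.FiniteDimensional
import Mathlib.Analysis.Convex.Topology
import Mathlib.Topology.Connected.PathConnected
import HarnessLib

/-!
# Staircase connectivity of planar domains; domains minus finitely many points

Topic `Literature/Topology/Euclidean`, namespace `Literature.Topology.Euclidean`.
Two facts of elementary planar topology, in the form needed to move marked points of a planar
domain one at a time along lattice directions (Chelkak–Hongler–Izyurov 2015, proof of Prop. 2.20:
"`γ` is any path in `Ω̃^{k+1}` … consisting of segments with all but one coordinates fixed"):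

* `isPreconnected_diff_finite` — an open connected subset of `ℂ` minus finitely many points is
  connected (through `isPreconnected_ball_diff_singleton`, the punctured disc);
* `staircase_of_isOpen_isPreconnected` — in an open connected `U ⊆ ℂ`, any two points are joined
  by a *staircase*: finitely many closed segments contained in `U`, each parallel to one of two
  fixed independent directions `u₁, u₂` (`Staircase U u₁ u₂`, the reflexive-transitive closure of
  the one-segment relation `StairStep U u₁ u₂`); with `staircase_diff_finite` the staircase also
  avoids a given finite set.

## References

* R. B. Burckel, *An Introduction to Classical Complex Analysis* I (1979), Ch. I §3 (polygonal
  connectedness of regions; regions minus discrete sets) [folklore].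
* D. Chelkak, C. Hongler, K. Izyurov, Ann. of Math. 181 (2015), §2.8, proof of Prop. 2.20 (the use)
  [ChelkakHonglerIzyurovAnnals2015].
-/

noncomputable section

open Set Metric Topology Filter

namespace Literature.Topology.Euclidean

/-! ### Punctured discs and domains minus finitely many points -/

/-- `ℂ` is a real plane: `1 < rank_ℝ ℂ`. [folklore] -/
theorem one_lt_rank_real_complex : 1 < Module.rank ℝ ℂ := by
  rw [Complex.rank_real_complex]
  norm_num

/-- **The punctured disc is connected.** [folklore] -/
theorem isPreconnected_ball_diff_singleton (p : ℂ) (r : ℝ) : IsPreconnected (ball p r \ {p}) := by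
  refine isPreconnected_of_forall_pair fun x hx y hy => ?_
  obtain ⟨hxb, hxp⟩ := hx
  obtain ⟨hyb, hyp⟩ := hy
  rw [mem_singleton_iff] at hxp hyp
  rw [mem_ball] at hxb hyb
  set rx := dist x p with hrx
  set ry := dist y p with hry
  have hrx0 : 0 < rx := dist_pos.2 hxp
  have hry0 : 0 < ry := dist_pos.2 hyp
  -- the connecting set: two circles and a radial segment
  set T : Set ℂ := (sphere p rx ∪ segment ℝ (p + rx) (p + ry)) ∪ sphere p ry with hT
  have hseg : ∀ z ∈ segment ℝ (p + (rx : ℂ)) (p + ry), ∃ s : ℝ, min rx ry ≤ s ∧ s ≤ max rx ry ∧ z = p + s := by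
    intro z hz
    rw [segment_eq_image'] at hz
    obtain ⟨θ, ⟨hθ0, hθ1⟩, rfl⟩ := hz
    refine ⟨rx + θ * (ry - rx), ?_, ?_, ?_⟩
    · rcases le_total rx ry with h | h
      · rw [min_eq_left h]; nlinarith
      · rw [min_eq_right h]; nlinarith
    · rcases le_total rx ry with h | h
      · rw [max_eq_right h]; nlinarith
      · rw [max_eq_left h]; nlinarith
    · show p + ↑rx + θ • (p + ↑ry - (p + ↑rx)) = p + ↑(rx + θ * (ry - rx))
      rw [Complex.real_smul]
      push_cast
      ring
  refine ⟨T, ?_, ?_, ?_, ?_⟩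
  · -- `T ⊆ ball p r \ {p}`
    rintro z ((hz | hz) | hz)
    · rw [mem_sphere] at hz
      refine ⟨mem_ball.2 (hz ▸ hxb), fun h => ?_⟩
      rw [mem_singleton_iff] at h
      rw [h, dist_self] at hz
      exact hrx0.ne' hz.symm
    · obtain ⟨s, hs1, hs2, rfl⟩ := hseg z hz
      have hs0 : 0 < s := lt_of_lt_of_le (lt_min hrx0 hry0) hs1
      have hsr : s < r := lt_of_le_of_lt hs2 (max_lt hxb hyb)
      have hd : dist (p + (s : ℂ)) p = s := by
        rw [dist_eq_norm, add_sub_cancel_left, Complex.norm_real, Real.norm_eq_abs, abs_of_pos hs0]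
      refine ⟨by rw [mem_ball, hd]; exact hsr, fun h => ?_⟩
      rw [mem_singleton_iff] at h
      rw [h, dist_self] at hd
      exact hs0.ne hd
    · rw [mem_sphere] at hz
      refine ⟨mem_ball.2 (hz ▸ hyb), fun h => ?_⟩
      rw [mem_singleton_iff] at h
      rw [h, dist_self] at hz
      exact hry0.ne' hz.symm
  · exact Or.inl (Or.inl (mem_sphere.2 rfl))
  · exact Or.inr (mem_sphere.2 rfl)
  · -- `T` is preconnected
    have hx1 : (p + (rx : ℂ)) ∈ sphere p rx := by
      rw [mem_sphere, dist_eq_norm, add_sub_cancel_left, Complex.norm_real, Real.norm_eq_abs,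
        abs_of_pos hrx0]
    have hy1 : (p + (ry : ℂ)) ∈ sphere p ry := by
      rw [mem_sphere, dist_eq_norm, add_sub_cancel_left, Complex.norm_real, Real.norm_eq_abs,
        abs_of_pos hry0]
    refine IsPreconnected.union (p + ry) (Or.inr (right_mem_segment _ _ _)) hy1 ?_
      (isConnected_sphere one_lt_rank_real_complex p hry0.le).isPreconnected
    exact IsPreconnected.union (p + rx) hx1 (left_mem_segment _ _ _)
      (isConnected_sphere one_lt_rank_real_complex p hrx0.le).isPreconnected
      (convex_segment _ _).isPreconnected

/-- **An open connected planar set minus a point is connected.** [folklore] -/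
theorem isPreconnected_diff_singleton {V : Set ℂ} (hV : IsOpen V) (hc : IsPreconnected V) (a : ℂ) :
    IsPreconnected (V \ {a}) := by
  by_cases ha : a ∈ V
  swap
  · rwa [sdiff_singleton_eq_self ha]
  obtain ⟨r, hr, hball⟩ := Metric.isOpen_iff.1 hV a ha
  set P : Set ℂ := ball a r \ {a} with hP
  have hPV : P ⊆ V \ {a} := sdiff_subset_sdiff_left hball
  have hPc : IsPreconnected P := isPreconnected_ball_diff_singleton a r
  -- a point of `P` inside any neighbourhood of `a`
  have hnear : ∀ v : Set ℂ, IsOpen v → a ∈ v → ∃ y ∈ P, y ∈ v := by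
    intro v hv hav
    obtain ⟨ρ, hρ, hρv⟩ := Metric.isOpen_iff.1 hv a hav
    set s : ℝ := min r ρ / 2 with hs
    have hs0 : 0 < s := by positivity
    have hsr : s < r := by
      have := min_le_left r ρ; rw [hs]; linarith
    have hsρ : s < ρ := by
      have := min_le_right r ρ; rw [hs]; linarith
    have hd : dist (a + (s : ℂ)) a = s := by
      rw [dist_eq_norm, add_sub_cancel_left, Complex.norm_real, Real.norm_eq_abs, abs_of_pos hs0]
    refine ⟨a + s, ⟨by rw [mem_ball, hd]; exact hsr, fun h => ?_⟩, hρv (by rw [mem_ball, hd]; exact hsρ)⟩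
    rw [mem_singleton_iff] at h
    rw [h, dist_self] at hd
    exact hs0.ne hd
  rw [isPreconnected_iff_subset_of_disjoint] at hc ⊢
  intro u v hu hv huv hdisj
  -- the punctured disc lies in `u` or in `v`
  have hPuv : P ⊆ u ∨ P ⊆ v := by
    rw [isPreconnected_iff_subset_of_disjoint] at hPc
    refine hPc u v hu hv (hPV.trans huv) ?_
    rw [← subset_empty_iff, ← hdisj]
    exact fun z hz => ⟨hPV hz.1, hz.2⟩
  -- the symmetric key step
  have key : ∀ u v : Set ℂ, IsOpen u → IsOpen v → V \ {a} ⊆ u ∪ v → (V \ {a}) ∩ (u ∩ v) = ∅ →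
      P ⊆ u → V \ {a} ⊆ u ∨ V \ {a} ⊆ v := by
    intro u v hu hv huv hdisj hPu
    have hav : a ∉ v := fun hav => by
      obtain ⟨y, hyP, hyv⟩ := hnear v hv hav
      have : y ∈ (V \ {a}) ∩ (u ∩ v) := ⟨hPV hyP, hPu hyP, hyv⟩
      rw [hdisj] at this
      exact this
    have hcov : V ⊆ (u ∪ ball a r) ∪ v := by
      intro x hx
      by_cases hxa : x = a
      · exact Or.inl (Or.inr (hxa ▸ mem_ball_self hr))
      · rcases huv ⟨hx, hxa⟩ with h | h
        · exact Or.inl (Or.inl h)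
        · exact Or.inr h
    have hdis : V ∩ ((u ∪ ball a r) ∩ v) = ∅ := by
      rw [← subset_empty_iff]
      rintro x ⟨hxV, hxu | hxb, hxv⟩
      · by_cases hxa : x = a
        · exact hav (hxa ▸ hxv)
        · have : x ∈ (V \ {a}) ∩ (u ∩ v) := ⟨⟨hxV, hxa⟩, hxu, hxv⟩
          rwa [hdisj] at this
      · by_cases hxa : x = a
        · exact hav (hxa ▸ hxv)
        · have : x ∈ (V \ {a}) ∩ (u ∩ v) := ⟨⟨hxV, hxa⟩, hPu ⟨hxb, hxa⟩, hxv⟩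
          rwa [hdisj] at this
    rcases hc (u ∪ ball a r) v (hu.union isOpen_ball) hv hcov hdis with h | h
    · left
      intro x hx
      rcases h hx.1 with hxu | hxb
      · exact hxu
      · exact hPu ⟨hxb, hx.2⟩
    · exact Or.inr (sdiff_subset.trans h)
  rcases hPuv with hPu | hPv
  · exact key u v hu hv huv hdisj hPu
  · rw [union_comm] at huv
    rw [inter_comm u v] at hdisj
    exact (key v u hv hu huv hdisj hPv).symm

/-- **An open connected planar set minus finitely many points is connected** (as a preconnected
set). [folklore] -/
theorem isPreconnected_diff_finite {U : Set ℂ} (hU : IsOpen U) (hc : IsPreconnected U) {F : Set ℂ}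
    (hF : F.Finite) : IsPreconnected (U \ F) := by
  induction F, hF using Set.Finite.induction_on with
  | empty => rwa [sdiff_empty]
  | @insert a s _ hs ih =>
    rw [show U \ insert a s = (U \ s) \ {a} by
      ext x; simp only [Set.mem_sdiff, mem_insert_iff, mem_singleton_iff]; tauto]
    exact isPreconnected_diff_singleton (hU.sdiff hs.isClosed) ih a

/-- A nonempty open subset of `ℂ` is infinite. [folklore] -/
theorem infinite_of_isOpen {U : Set ℂ} (hU : IsOpen U) (hne : U.Nonempty) : U.Infinite := by
  obtain ⟨z, hz⟩ := hne
  exact infinite_of_mem_nhds z (hU.mem_nhds hz)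

/-- **An open connected planar set minus finitely many points is connected.** [folklore] -/
theorem isConnected_diff_finite {U : Set ℂ} (hU : IsOpen U) (hc : IsConnected U) {F : Set ℂ}
    (hF : F.Finite) : IsConnected (U \ F) :=
  ⟨((infinite_of_isOpen hU hc.nonempty).sdiff hF).nonempty, isPreconnected_diff_finite hU hc.2 hF⟩

/-! ### Staircases -/

/-- One step of a staircase in `U` with directions `u₁, u₂`: `w = z + t uᵢ` for a real `t` and one
of the two directions, and the closed segment `[z, w]` lies in `U`. [folklore] -/
def StairStep (U : Set ℂ) (u₁ u₂ : ℂ) (z w : ℂ) : Prop :=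
  segment ℝ z w ⊆ U ∧ ∃ t : ℝ, w = z + t * u₁ ∨ w = z + t * u₂

/-- A staircase in `U` with directions `u₁, u₂`: finitely many steps (the reflexive-transitive
closure of `StairStep U u₁ u₂`). [folklore] -/
def Staircase (U : Set ℂ) (u₁ u₂ : ℂ) : ℂ → ℂ → Prop :=
  Relation.ReflTransGen (StairStep U u₁ u₂)

variable {U U' : Set ℂ} {u₁ u₂ : ℂ}

/-- Steps are symmetric. [folklore] -/
theorem StairStep.symm {z w : ℂ} (h : StairStep U u₁ u₂ z w) : StairStep U u₁ u₂ w z := by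
  refine ⟨(segment_symm ℝ w z).symm ▸ h.1, ?_⟩
  obtain ⟨t, ht | ht⟩ := h.2
  · exact ⟨-t, Or.inl (by rw [ht]; push_cast; ring)⟩
  · exact ⟨-t, Or.inr (by rw [ht]; push_cast; ring)⟩

/-- Steps are monotone in the set. [folklore] -/
theorem StairStep.mono (hU : U ⊆ U') {z w : ℂ} (h : StairStep U u₁ u₂ z w) : StairStep U' u₁ u₂ z w :=
  ⟨h.1.trans hU, h.2⟩

/-- The endpoints of a step lie in `U`. [folklore] -/
theorem StairStep.right_mem {z w : ℂ} (h : StairStep U u₁ u₂ z w) : w ∈ U :=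
  h.1 (right_mem_segment ℝ z w)

/-- The trivial staircase. [folklore] -/
theorem Staircase.refl (z : ℂ) : Staircase U u₁ u₂ z z := Relation.ReflTransGen.refl

/-- Concatenation of staircases. [folklore] -/
theorem Staircase.trans {x y z : ℂ} (h₁ : Staircase U u₁ u₂ x y) (h₂ : Staircase U u₁ u₂ y z) :
    Staircase U u₁ u₂ x z := Relation.ReflTransGen.trans h₁ h₂

/-- A single step is a staircase. [folklore] -/
theorem Staircase.single {z w : ℂ} (h : StairStep U u₁ u₂ z w) : Staircase U u₁ u₂ z w :=
  Relation.ReflTransGen.single h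

/-- Staircases are symmetric. [folklore] -/
theorem Staircase.symm {z w : ℂ} (h : Staircase U u₁ u₂ z w) : Staircase U u₁ u₂ w z := by
  induction h with
  | refl => exact Relation.ReflTransGen.refl
  | tail _ hbc ih => exact Relation.ReflTransGen.head hbc.symm ih

/-- Staircases are monotone in the set. [folklore] -/
theorem Staircase.mono (hU : U ⊆ U') {z w : ℂ} (h : Staircase U u₁ u₂ z w) : Staircase U' u₁ u₂ z w := by
  induction h with
  | refl => exact Relation.ReflTransGen.refl
  | tail _ hbc ih => exact Relation.ReflTransGen.tail ih (hbc.mono hU)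

/-- The far end of a nontrivial staircase from a point of `U` lies in `U`. [folklore] -/
theorem Staircase.right_mem {z w : ℂ} (h : Staircase U u₁ u₂ z w) (hz : z ∈ U) : w ∈ U := by
  induction h with
  | refl => exact hz
  | tail _ h _ => exact h.right_mem

/-! ### Coordinates with respect to two independent directions -/

/-- The planar cross product `a × b = Re a · Im b - Im a · Re b`. [folklore] -/
def cross (a b : ℂ) : ℝ := a.re * b.im - a.im * b.re

/-- `a × b = Im(ā b)`. [folklore] -/
theorem cross_eq_im_conj_mul (a b : ℂ) : cross a b = ((starRingEnd ℂ) a * b).im := by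
  simp [cross, Complex.mul_im]; ring

/-- `|a × b| ≤ |a| |b|`. [folklore] -/
theorem abs_cross_le (a b : ℂ) : |cross a b| ≤ ‖a‖ * ‖b‖ := by
  rw [cross_eq_im_conj_mul]
  refine le_trans (Complex.abs_im_le_norm _) ?_
  rw [norm_mul, Complex.norm_conj]

/-- **Cramer's rule in the plane**: `d = (d × u₂)/(u₁ × u₂) · u₁ + (u₁ × d)/(u₁ × u₂) · u₂` when
`u₁ × u₂ ≠ 0`. [folklore] -/
theorem eq_cross_div_mul_add (h : cross u₁ u₂ ≠ 0) (d : ℂ) :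
    d = ((cross d u₂ / cross u₁ u₂ : ℝ) : ℂ) * u₁ + ((cross u₁ d / cross u₁ u₂ : ℝ) : ℂ) * u₂ := by
  have key : ((cross u₁ u₂ : ℝ) : ℂ) * d = ((cross d u₂ : ℝ) : ℂ) * u₁ + ((cross u₁ d : ℝ) : ℂ) * u₂ := by
    apply Complex.ext
    · simp only [cross, Complex.mul_re, Complex.add_re, Complex.ofReal_re, Complex.ofReal_im, zero_mul,
        sub_zero]
      ring
    · simp only [cross, Complex.mul_im, Complex.add_im, Complex.ofReal_re, Complex.ofReal_im, zero_mul,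
        add_zero]
      ring
  have hc : ((cross u₁ u₂ : ℝ) : ℂ) ≠ 0 := Complex.ofReal_ne_zero.2 h
  rw [Complex.ofReal_div, Complex.ofReal_div, div_mul_eq_mul_div, div_mul_eq_mul_div, ← add_div,
    eq_div_iff hc, ← key, mul_comm]

/-! ### Local and global staircase connectivity -/

/-- **Two steps inside a disc**: if the disc `B(w, r)` lies in `U` and `u₁ × u₂ ≠ 0`, every point of
the smaller disc `B(w, r/(C+1))`, `C = |u₁||u₂|/|u₁ × u₂|`, is reached from `w` by a staircase of two
steps inside `B(w,r)` (through the corner `w + s u₁`). [folklore] -/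
theorem staircase_of_mem_ball (h : cross u₁ u₂ ≠ 0) {w : ℂ} {r : ℝ} (hball : ball w r ⊆ U) {w' : ℂ}
    (hw' : w' ∈ ball w (r / (‖u₁‖ * ‖u₂‖ / |cross u₁ u₂| + 1))) : Staircase U u₁ u₂ w w' := by
  set C : ℝ := ‖u₁‖ * ‖u₂‖ / |cross u₁ u₂| with hC
  have hC0 : 0 ≤ C := by positivity
  have hcr : 0 < |cross u₁ u₂| := abs_pos.2 h
  set d := w' - w with hd
  have hdlt : ‖d‖ < r / (C + 1) := by rwa [hd, ← dist_eq_norm, ← mem_ball]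
  have hr : 0 < r := by
    have := lt_of_le_of_lt (norm_nonneg d) hdlt
    have hC1 : 0 < C + 1 := by linarith
    exact (div_pos_iff_of_pos_right hC1).1 this
  have hdr : ‖d‖ < r := lt_of_lt_of_le hdlt (div_le_self hr.le (by linarith))
  set s : ℝ := cross d u₂ / cross u₁ u₂ with hs
  set t : ℝ := cross u₁ d / cross u₁ u₂ with ht
  obtain ⟨c, hc⟩ : ∃ c : ℂ, c = w + (s : ℂ) * u₁ := ⟨_, rfl⟩
  have hdecomp : d = (s : ℂ) * u₁ + (t : ℂ) * u₂ := eq_cross_div_mul_add h d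
  -- the corner is in the disc
  have hcs : ‖(s : ℂ) * u₁‖ ≤ ‖d‖ * C := by
    rw [norm_mul, Complex.norm_real, Real.norm_eq_abs, hs, abs_div, hC]
    have h1 : |cross d u₂| ≤ ‖d‖ * ‖u₂‖ := abs_cross_le d u₂
    rw [div_mul_eq_mul_div, div_le_iff₀ hcr]
    calc |cross d u₂| * ‖u₁‖ ≤ ‖d‖ * ‖u₂‖ * ‖u₁‖ := by gcongr
      _ = ‖d‖ * (‖u₁‖ * ‖u₂‖ / |cross u₁ u₂|) * |cross u₁ u₂| := by field_simp
  have hcball : c ∈ ball w r := by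
    rw [mem_ball, dist_eq_norm, hc, add_sub_cancel_left]
    refine lt_of_le_of_lt hcs ?_
    have hC1 : 0 < C + 1 := by linarith
    calc ‖d‖ * C ≤ r / (C + 1) * C := by gcongr
      _ < r := by rw [div_mul_eq_mul_div, div_lt_iff₀ hC1]; nlinarith
  have hw'ball : w' ∈ ball w r := by rw [mem_ball, dist_eq_norm, ← hd]; exact hdr
  have hconv : Convex ℝ (ball w r) := convex_ball w r
  refine Staircase.trans (Staircase.single ⟨?_, s, Or.inl hc⟩) (Staircase.single ⟨?_, t, Or.inr ?_⟩)
  · exact (hconv.segment_subset (mem_ball_self hr) hcball).trans hball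
  · exact (hconv.segment_subset hcball hw'ball).trans hball
  · rw [hc, add_assoc, ← hdecomp, hd]; ring

/-- **Staircase connectivity of planar domains**: in an open connected `U ⊆ ℂ`, any two points are
joined by a staircase in `U` with any two prescribed independent directions `u₁, u₂` (the set of
points reachable from `z` is open and closed in `U`). [folklore] -/
theorem staircase_of_isOpen_isPreconnected (hU : IsOpen U) (hc : IsPreconnected U)
    (h : cross u₁ u₂ ≠ 0) {z w : ℂ} (hz : z ∈ U) (hw : w ∈ U) : Staircase U u₁ u₂ z w := by
  set S : Set ℂ := {x | x ∈ U ∧ Staircase U u₁ u₂ z x} with hS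
  set T : Set ℂ := {x | x ∈ U ∧ ¬Staircase U u₁ u₂ z x} with hT
  set C : ℝ := ‖u₁‖ * ‖u₂‖ / |cross u₁ u₂| with hC
  have hC0 : 0 ≤ C := by positivity
  have hC1 : 0 < C + 1 := by linarith
  have hSopen : IsOpen S := by
    refine Metric.isOpen_iff.2 fun x hx => ?_
    obtain ⟨r, hr, hball⟩ := Metric.isOpen_iff.1 hU x hx.1
    refine ⟨r / (C + 1), div_pos hr hC1, fun y hy => ?_⟩
    have hxy : Staircase U u₁ u₂ x y := staircase_of_mem_ball h hball hy
    exact ⟨hxy.right_mem hx.1, hx.2.trans hxy⟩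
  have hTopen : IsOpen T := by
    refine Metric.isOpen_iff.2 fun x hx => ?_
    obtain ⟨r, hr, hball⟩ := Metric.isOpen_iff.1 hU x hx.1
    refine ⟨r / (C + 1), div_pos hr hC1, fun y hy => ?_⟩
    have hxy : Staircase U u₁ u₂ x y := staircase_of_mem_ball h hball hy
    exact ⟨hxy.right_mem hx.1, fun hzy => hx.2 (hzy.trans hxy.symm)⟩
  have hUST : U ⊆ S ∪ T := fun x hx => by
    by_cases hx' : Staircase U u₁ u₂ z x
    · exact Or.inl ⟨hx, hx'⟩
    · exact Or.inr ⟨hx, hx'⟩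
  have hdisj : Disjoint S T := disjoint_left.2 fun x hxS hxT => hxT.2 hxS.2
  rcases hc.subset_or_subset hSopen hTopen hdisj hUST with hUS | hUT
  · exact (hUS hw).2
  · exact absurd (Staircase.refl z) (hUT hz).2

/-- **Staircases avoiding finitely many points**: in an open connected `U ⊆ ℂ`, two points outside a
finite set `F` are joined by a staircase in `U ∖ F`. [folklore] -/
theorem staircase_diff_finite (hU : IsOpen U) (hc : IsPreconnected U) {F : Set ℂ} (hF : F.Finite)
    (h : cross u₁ u₂ ≠ 0) {z w : ℂ} (hz : z ∈ U \ F) (hw : w ∈ U \ F) : Staircase (U \ F) u₁ u₂ z w :=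
  staircase_of_isOpen_isPreconnected (hU.sdiff hF.isClosed) (isPreconnected_diff_finite hU hc hF) h hz hw

/-- The two diagonal directions `1 + i`, `1 - i` of the square lattice are independent:
`(1+i) × (1-i) = -2`. [folklore] -/
theorem cross_diag_ne_zero : cross (1 + Complex.I) (1 - Complex.I) ≠ 0 := by
  simp [cross]; norm_num

/-- The two axis directions `1`, `i` are independent: `1 × i = 1`. [folklore] -/
theorem cross_one_I_ne_zero : cross 1 Complex.I ≠ 0 := by
  simp [cross]

end Literature.Topology.Euclidean
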